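import Literature.AlgebraicGeometry.Frobenioids.RlfPrimes
import Literature.AlgebraicGeometry.Frobenioids.FactorizationTransport
import HarnessLib

/-!
# Frobenioids I, Def. 2.4 (i): "`M^rlf` is also perf-factorial" (proof)

Mochizuki, *The geometry of Frobenioids I*, Kyushu J. Math. **62** (2008), §2, Definition 2.4 (i),
kurims p. 48 [cite: MochizukiFrdI2008, Def. 2.4(i) p.48].  Proof-side companion of
`PerfFactorial.lean` (abc-iut node `FrdI:Def2.4(i)`, last closing claim):
`IsPerfFactorial.RealificationIsPerfFactorial_holds` — for a perf-factorial monoid `M`, the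
realification `M^rlf` is perf-factorial.

Conditions (a), (b) are `RlfStructure.lean` / `RlfPrimes.lean`.  For (c), (d) the factorization data
of `M^rlf` relative to its own primes (`Factorization.lean`) is computed directly: for the prime `𝔮̃`
of `M^rlf` corresponding to `𝔮 ∈ Prime(M^pf)`, the set `Bound_{𝔮̃ ∪ {0}}(a)` has the MAXIMUM
`a|_𝔮 ⊗ 1` (the restriction of `a` to the prime `𝔮`), so the factorization map of `M^rlf` is
`a ↦ (a|_𝔮 ⊗ 1)_{𝔮̃}` — an injective homomorphism with image in `∏ (M^rlf)_𝔮̃` satisfying (d)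
(`IsPerfFactorial.Rlf.cond`).  Conditions (c), (d) for `(M^rlf)^pf` then follow by transport along
`M^rlf ≅ (M^rlf)^pf` (`M^rlf` is perfect; `FactorizationTransport.lean`).  No statement of the paper
is strengthened; multiplicative notation as in `Monoids.lean`.
-/

noncomputable section

namespace Literature.AlgebraicGeometry.Frobenioids

open Function

universe u

/-- If `s` is a supremum of `S` for the divisibility order and that order is antisymmetric, then
`divSup S = s`. [cite: MochizukiFrdI2008, §0 p.12] -/
theorem divSup_eq_of_isSup {R : Type u} [CommMonoid R]
    (hanti : ∀ s₁ s₂ : R, s₁ ∣ s₂ → s₂ ∣ s₁ → s₁ = s₂) {S : Set R} {s : R}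
    (hs : ∀ b : R, IsBoundedBy S b ↔ s ∣ b) : divSup S = s := by
  have hspec : ∀ b, IsBoundedBy S b ↔ divSup S ∣ b := divSup_spec ⟨s, hs⟩
  exact hanti _ _ ((hspec s).mp ((hs s).mpr dvd_rfl)) ((hs _).mp ((hspec _).mpr dvd_rfl))

namespace IsPerfFactorial

variable {M : Type u} [CommMonoid M] (h : IsPerfFactorial M)

namespace Rlf

/-- The prime `𝔮 ∈ Prime(M^pf)` under a prime `𝔮̃` of `M^rlf`. [cite: MochizukiFrdI2008, Def. 2.4(i) p.48] -/
abbrev idx (P : Primes h.Rlf) : Primes (Perfection M) := primeSupp h P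

/-- `primeOf (idx 𝔮̃) = 𝔮̃`. [cite: MochizukiFrdI2008, Def. 2.4(i) p.48] -/
theorem primeOf_idx (P : Primes h.Rlf) : primeOf h (idx h P) = P := primeOf_primeSupp h P

/-- `idx (primeOf 𝔮) = 𝔮`. [cite: MochizukiFrdI2008, Def. 2.4(i) p.48] -/
theorem idx_primeOf (𝔮 : Primes (Perfection M)) : idx h (primeOf h 𝔮) = 𝔮 := primeSupp_primeOf h 𝔮

/-- `(M^rlf)_𝔮̃ = {a | Supp(a) ⊆ {idx 𝔮̃}}`. [cite: MochizukiFrdI2008, Def. 2.4(i) p.48] -/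
theorem mem_submonoid_iff (P : Primes h.Rlf) (a : h.Rlf) :
    a ∈ P.submonoid ↔ supp (a : RlfFactor M) ⊆ {idx h P} := by
  have := mem_submonoid_primeOf_iff h (idx h P) a
  rwa [primeOf_idx] at this

/-- An element of `(M^rlf)_𝔮̃` has trivial components away from `idx 𝔮̃`. [cite: MochizukiFrdI2008, Def. 2.4(i) p.48] -/
theorem apply_eq_one_of_mem_submonoid {P : Primes h.Rlf} {a : h.Rlf} (ha : a ∈ P.submonoid)
    {𝔮 : Primes (Perfection M)} (h𝔮 : 𝔮 ≠ idx h P) : (a : RlfFactor M) 𝔮 = 1 := by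
  by_contra hne
  exact h𝔮 ((mem_submonoid_iff h P a).mp ha hne)

/-- The restriction `a|_𝔮` as an element of `(M^rlf)_𝔮̃` (`𝔮 = idx 𝔮̃`). [cite: MochizukiFrdI2008, Def. 2.4(i) p.48] -/
def res (P : Primes h.Rlf) (a : h.Rlf) : Factorization.PAt h.Rlf P :=
  ⟨h.restrict (idx h P) a, (mem_submonoid_iff h P _).mpr (h.supp_restrict_subset _ a)⟩

/-- `res` on underlying elements. [cite: MochizukiFrdI2008, Def. 2.4(i) p.48] -/
@[simp] theorem coe_res (P : Primes h.Rlf) (a : h.Rlf) : ((res h P a : h.Rlf) : RlfFactor M) =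
    single' (idx h P) ((a : RlfFactor M) (idx h P)) := rfl

/-- `res` is multiplicative. [cite: MochizukiFrdI2008, Def. 2.4(i) p.48] -/
theorem res_mul (P : Primes h.Rlf) (a b : h.Rlf) : res h P (a * b) = res h P a * res h P b :=
  Subtype.ext (map_mul (h.restrictHom (idx h P)) a b)

/-- `res 1 = 1`. [cite: MochizukiFrdI2008, Def. 2.4(i) p.48] -/
theorem res_one (P : Primes h.Rlf) : res h P 1 = 1 :=
  Subtype.ext (map_one (h.restrictHom (idx h P)))

/-- `a|_𝔮 ⊗ 1 ∈ Bound_{𝔮̃ ∪ {0}}(a)`. [cite: MochizukiFrdI2008, Def. 2.4(i) p.48] -/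
theorem of_res_mem_bound (P : Primes h.Rlf) (a : h.Rlf) :
    Realification.of _ (res h P a) ∈ Factorization.bound h.Rlf P a := by
  refine ⟨res h P a, ?_, h.restrict_dvd _ a, rfl⟩
  by_cases ha : (a : RlfFactor M) (idx h P) = 1
  · right
    apply Subtype.ext
    show single' (idx h P) ((a : RlfFactor M) (idx h P)) = 1
    rw [ha, single'_one]
  · left
    have key : h.restrict (idx h P) a ∈ (primeOf h (idx h P)).carrier := by
      rw [mem_carrier_primeOf_iff]
      refine Set.Subset.antisymm (h.supp_restrict_subset _ a) (Set.singleton_subset_iff.mpr ?_)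
      show single' (idx h P) ((a : RlfFactor M) (idx h P)) (idx h P) ≠ 1
      rwa [single'_apply_same]
    rw [primeOf_idx] at key
    exact key

/-- Every element of `Bound_{𝔮̃ ∪ {0}}(a)` is `≤ a|_𝔮 ⊗ 1`: the supremum is a maximum.
[cite: MochizukiFrdI2008, Def. 2.4(i) p.48] -/
theorem dvd_of_res_of_mem_bound (P : Primes h.Rlf) (a : h.Rlf) {y : Factorization.RAt h.Rlf P}
    (hy : y ∈ Factorization.bound h.Rlf P a) : y ∣ Realification.of _ (res h P a) := by
  obtain ⟨x, _, hxa, rfl⟩ := hy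
  apply map_dvd
  -- `x ≤ a|_𝔮` inside `(M^rlf)_𝔮̃`
  have hdvd : (x : h.Rlf) ∣ (res h P a : h.Rlf) := by
    rw [dvd_iff]
    intro 𝔮
    rw [coe_res]
    by_cases h𝔮 : 𝔮 = idx h P
    · rw [h𝔮, single'_apply_same]
      exact ((dvd_iff h _ _).mp hxa) _
    · rw [apply_eq_one_of_mem_submonoid h x.2 h𝔮]
      exact one_dvd _
  obtain ⟨c, hc⟩ := hdvd
  have hcmem : c ∈ P.submonoid := by
    rw [mem_submonoid_iff]
    refine Set.Subset.trans ?_ ((mem_submonoid_iff h P _).mp (res h P a).2)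
    rw [hc, coe_mul, mul_comm]
    exact supp_subset_supp_mul _ _
  exact ⟨⟨c, hcmem⟩, Subtype.ext hc⟩

/-- **`a|_𝔮 ⊗ 1 = sup Bound_{𝔮̃ ∪ {0}}(a)`**: "bounded by `b` iff `b ≥ a|_𝔮 ⊗ 1`".
[cite: MochizukiFrdI2008, Def. 2.4(i) p.48] -/
theorem isSup_bound (P : Primes h.Rlf) (a : h.Rlf) (b : Factorization.RAt h.Rlf P) :
    IsBoundedBy (Factorization.bound h.Rlf P a) b ↔ Realification.of _ (res h P a) ∣ b :=
  ⟨fun hb => hb _ (of_res_mem_bound h P a),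
    fun hb _ hy => (dvd_of_res_of_mem_bound h P a hy).trans hb⟩

/-- **The factorization map of `M^rlf` is `a ↦ (a|_𝔮 ⊗ 1)_𝔮̃`.** [cite: MochizukiFrdI2008, Def. 2.4(i) p.48] -/
theorem fmap_apply (a : h.Rlf) (P : Primes h.Rlf) :
    Factorization.fmap h.Rlf a P = Realification.of _ (res h P a) :=
  divSup_eq_of_isSup (fun _ _ => Realification.dvd_antisymm) (isSup_bound h P a)

/-- `N → N ⊗ ℝ_{≥0}` is injective on each `(M^rlf)_𝔮̃` (which is monoprime). [cite: MochizukiFrdI2008, Def. 2.4(i) p.48] -/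
theorem of_injective (P : Primes h.Rlf) : Injective (Realification.of (Factorization.PAt h.Rlf P)) :=
  Realification.of_injective (isMonoprime_submonoid h P)

/-- `restrict 𝔮 a = restrict 𝔮 b` for all `𝔮` forces `a = b`. [cite: MochizukiFrdI2008, Def. 2.4(i) p.48] -/
theorem eq_of_restrict_eq {a b : h.Rlf} (hab : ∀ 𝔮, h.restrict 𝔮 a = h.restrict 𝔮 b) : a = b := by
  apply Subtype.ext
  funext 𝔮
  have := congrArg (fun z : h.Rlf => (z : RlfFactor M) 𝔮) (hab 𝔮)
  simpa only [coe_restrict, single'_apply_same] using this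

/-- Index bookkeeping: the underlying element of `x_𝔮̃` only depends on `𝔮̃` up to equality.
[cite: MochizukiFrdI2008, Def. 2.4(i) p.48] -/
theorem coe_apply_congr (x : Factorization.PFactor h.Rlf) {P₁ P₂ : Primes h.Rlf} (e : P₁ = P₂) :
    ((x P₁ : h.Rlf) : RlfFactor M) = ((x P₂ : h.Rlf) : RlfFactor M) := by
  subst e
  rfl

/-- The candidate preimage for condition (d): glue the `𝔮`-components of the `x_{𝔮̃(𝔮)}`.
[cite: MochizukiFrdI2008, Def. 2.4(i) p.48] -/
def glue (x : Factorization.PFactor h.Rlf) : RlfFactor M :=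
  fun 𝔮 => ((x (primeOf h 𝔮) : h.Rlf) : RlfFactor M) 𝔮

/-- If `Supp(x ⊗ 1) ⊆ Supp(fmap b)` then `Supp(glue x) ⊆ Supp(b)`, so `glue x ∈ M^rlf`.
[cite: MochizukiFrdI2008, Def. 2.4(i) p.48] -/
theorem supp_glue_subset (x : Factorization.PFactor h.Rlf) (b : h.Rlf)
    (hx : Factorization.supp (Factorization.pToR h.Rlf x) ⊆ Factorization.supp (Factorization.fmap h.Rlf b)) :
    supp (glue h x) ⊆ supp (b : RlfFactor M) := by
  intro 𝔮 h𝔮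
  have hx1 : x (primeOf h 𝔮) ≠ 1 := by
    intro h1
    apply h𝔮
    show ((x (primeOf h 𝔮) : h.Rlf) : RlfFactor M) 𝔮 = 1
    rw [h1]
    rfl
  have hP : primeOf h 𝔮 ∈ Factorization.supp (Factorization.pToR h.Rlf x) := by
    intro h1
    rw [Factorization.pToR_apply] at h1
    exact hx1 (of_injective h _ (by rw [h1, map_one]))
  have hb := hx hP
  intro hb𝔮
  apply hb
  rw [fmap_apply]
  have : res h (primeOf h 𝔮) b = 1 := by
    apply Subtype.ext
    apply Subtype.ext
    show single' (idx h (primeOf h 𝔮)) ((b : RlfFactor M) (idx h (primeOf h 𝔮))) = 1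
    rw [idx_primeOf, hb𝔮, single'_one]
  rw [this, map_one]

/-- The glued element of `M^rlf`. [cite: MochizukiFrdI2008, Def. 2.4(i) p.48] -/
def glued (x : Factorization.PFactor h.Rlf) (b : h.Rlf)
    (hx : Factorization.supp (Factorization.pToR h.Rlf x) ⊆ Factorization.supp (Factorization.fmap h.Rlf b)) :
    h.Rlf :=
  ⟨glue h x, by
    obtain ⟨b₀, hb₀⟩ := b.2
    exact ⟨b₀, (supp_glue_subset h x b hx).trans hb₀⟩⟩

/-- `res 𝔮̃ (glued x) = x_𝔮̃`. [cite: MochizukiFrdI2008, Def. 2.4(i) p.48] -/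
theorem res_glued (x : Factorization.PFactor h.Rlf) (b : h.Rlf)
    (hx : Factorization.supp (Factorization.pToR h.Rlf x) ⊆ Factorization.supp (Factorization.fmap h.Rlf b))
    (P : Primes h.Rlf) : res h P (glued h x b hx) = x P := by
  apply Subtype.ext
  apply Subtype.ext
  funext 𝔮
  show single' (idx h P) (glue h x (idx h P)) 𝔮 = ((x P : h.Rlf) : RlfFactor M) 𝔮
  by_cases h𝔮 : 𝔮 = idx h P
  · subst h𝔮
    rw [single'_apply_same, glue, coe_apply_congr h x (primeOf_idx h P)]
  · rw [single'_apply_of_ne h𝔮, apply_eq_one_of_mem_submonoid h (x P).2 h𝔮]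

/-- **Conditions (c), (d) of Def. 2.4 (i) for `M^rlf` relative to its own primes.**
[cite: MochizukiFrdI2008, Def. 2.4(i) p.48] -/
theorem cond : Factorization.Cond h.Rlf where
  bounded P a := ⟨_, (isSup_bound h P a _).mpr dvd_rfl⟩
  fmap_one := funext fun P => by rw [fmap_apply, res_one, map_one, Pi.one_apply]
  fmap_mul a b := funext fun P => by rw [Pi.mul_apply, fmap_apply, fmap_apply, fmap_apply, res_mul, map_mul]
  fmap_injective a b hab := by
    apply eq_of_restrict_eq h
    intro 𝔮
    have h1 := congr_fun hab (primeOf h 𝔮)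
    rw [fmap_apply, fmap_apply] at h1
    have h2 := congrArg Subtype.val (of_injective h _ h1)
    have h3 : h.restrict (idx h (primeOf h 𝔮)) a = h.restrict (idx h (primeOf h 𝔮)) b := h2
    rwa [idx_primeOf] at h3
  fmap_mem_range a := ⟨fun P => res h P a, funext fun P => by rw [Factorization.pToR_apply, fmap_apply]⟩
  mem_range_of_supp_subset x b hx := ⟨glued h x b hx, funext fun P => by
    rw [fmap_apply, Factorization.pToR_apply, res_glued]⟩

end Rlf

/-- **Definition 2.4 (i), p. 48: "… one verifies immediately that … `M^rlf` [is] also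
perf-factorial"** — the named statement `IsPerfFactorial.RealificationIsPerfFactorial` of
`PerfFactorial.lean`, discharged: (a) `M^rlf` is divisorial (`RlfStructure.lean`); (b) every
`(M^rlf)_𝔮̃ ≅ M^rlf_𝔮` is monoprime (`RlfPrimes.lean`); (c), (d) hold for `M^rlf` relative to its
primes (`Rlf.cond`) and are transported to `(M^rlf)^pf` along `M^rlf ≅ (M^rlf)^pf`.
[cite: MochizukiFrdI2008, Def. 2.4(i) p.48] -/
theorem RealificationIsPerfFactorial_holds : h.RealificationIsPerfFactorial :=
  IsPerfFactorial.of_cond (Rlf.isDivisorial h) (Rlf.isMonoprime_submonoid h)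
    (Factorization.Cond.of_mulEquiv (Rlf.isPerfect h).equivPerfection (Rlf.cond h))

/-- **`ℝ` supports `M^rlf`** (Def. 2.4 (ii)(c): `M^rlf` is perfect and perf-factorial and every
`(M^rlf)_𝔭` is `ℝ`-monoprime) — the form in which realified divisor monoids are used (e.g. [FrdI]
Prop. 5.3, "the realification `C^rlf`"). [cite: MochizukiFrdI2008, Def. 2.4(ii) p.48] -/
theorem supports_rlf_R : Supports h.Rlf .R :=
  ⟨Rlf.isPerfect h, h.RealificationIsPerfFactorial_holds, Rlf.isRMonoprime_submonoid h⟩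

/-- **`ℚ` supports `M^pf`** (Def. 2.4 (ii)(b): `M^pf` is perfect). [cite: MochizukiFrdI2008, Def. 2.4(ii) p.48] -/
theorem _root_.Literature.AlgebraicGeometry.Frobenioids.supports_Q_perfection (N : Type u) [CommMonoid N] :
    Supports (Perfection N) .Q :=
  isPerfect_perfection

end IsPerfFactorial

end Literature.AlgebraicGeometry.Frobenioids
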